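import Summits.BirchSwinnertonDyer.BirchSwinnertonDyer.Theorems.AdditiveBranchIMCGordTwoRankOneUnitSliceCrux
import Summits.BirchSwinnertonDyer.BirchSwinnertonDyer.Theorems.AdditiveBranchIMCGordTwoRankOneUnitCoeff
import HarnessLib

/-!
# Route `AdditiveBranchIMC` (rung K1), crux `GordTwoRankOne` (item 19358): the `#Ш_an`-UNIT WINDOW — on a rank-one
# row with the per-pair DATUM `shaAn W = s`, `ord_p s ≤ 0` the crux's lower half is FREE, and `BSD(E,p)` on X4♯ ∩ surj
# / X3♯ needs only the Euler-system half + `A′ ≠ 0` (cell `bsd-addord`, seat `bsd-addord-k1-c3` gen 5, D-0074 row B2)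

HONEST FRAMING. THEOREMS ONLY: no definition, no named fact, no `sorry`, nothing booked; BSD is not proved by
any of this; crux `GordTwoRankOne` (∀ `E/ℚ` of analytic rank `1`, ∀ odd additive (G)-ordinary `p`, `e = 2`:
`ord_p #Ш(E)_an ≤ ord_p #Ш(E)`) stays OPEN at class level — after this file exactly on its CONTENT WINDOW
`p ∣ #Ш(E)_an` (§3), where the Λ-adic children `GordTwoLambdaEven` / `GordTwoLambdaOdd` (items 19497/19498,
NOT in print) and the certificate child `GordTwoRankOneClassCert` (19499) carry content.

THE OBSERVATION (gen 5). The crux's currency `Typed.MissingLowerBoundAt W p` is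
`∃ q : ℚ, shaAn W = q ∧ padicValRat p q ≤ padicValNat p #Ш(E)`, right side `≥ 0`. So on every row carrying
the per-pair DATUM "`#Ш(E)_an` is the rational `s`, `ord_p s ≤ 0`" the lower half holds with NO input (§0; the
tree's class-free `N10.missingLowerBoundAt_of_padicValRat_le_zero`, stated by b2b for the rank-0 class N10): no
Λ-adic containment, no `p`-adic Gross–Zagier, no Schneider, no reading, no certificate. The datum is an admitted
per-pair currency in analytic rank ONE — the hypothesis `(hq : shaAn W = q) (hv : padicValRat p q = 0)` of the
class-free kernel `Typed.bsdp_of_card_selmerGroup_eq_pow_analyticRank` of the rank-one `p = 3` bookings F3BW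
(referee A R198.17 / R202.3) — and the cell's TARGET §2 calls its complement the CONTENT window `p ∣ #Ш_an`.
Gens 0–4 reached the lower half THROUGH the kernel identity from the Λ-adic containment or from the UNIT
certificate `‖A′‖_p = 1`; by that identity `v_p(A′) = ord_p #Ш_an + ord_p ∏c_ℓ + ord_p Reg_p − 1 − 2 ord_p #tors`,
so a row with `v_p(A′) ≥ 1` (engine valuation `≥ 2`: 13/119 of proof/gz4, 146/639 of proof/gz5-p3) whose valuation
comes from the regulator / a Tamagawa number and not from `#Ш_an` is a window row outside the unit slice.

CONSEQUENCE (per pair; B6 = (G-ord, `e = 2`) r1). `BSD(E,p)` = lower + upper; the UPPER half is gen 0's theorem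
from ONE identity + Kato's (X4♯ ∩ surj) / Wuthrich's (X3♯) half + Schneider-for-the-datum (= the identity read
with `A′ ≠ 0`). §1 X4♯(G-ord) ∩ `I₀*` ∩ {`ρ̄` onto}, `r_an = 1`, `p ≡ 1 (4)` / `p ≡ 3 (4), p ≥ 7` / `p = 3`:
`BSD(E,p)` ⟸ `hK` + cite-only `hCyc hArt h73 hWald hmod hmodD hmodN hGZK` + `BranchCoeffOneNeZeroAt W p` (`A′ ≠ 0`,
ANY valuation) + the datum — NO `hMaz hDel hDel3 hCyc3`, NO unit coefficient / budget / non-anomalous binder.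
§2 X3♯(G-ord) ∩ `I₀*`, same parities: `BSD(E,p)` ⟸ `hW16` + the same + `A′ ≠ 0` + the datum — NO Greenberg–Vatsal
facts `hGV h23 h414 hGrK hLiftF hLiftE`, NO line datum `Φ₀` / parity / inertia clause, NO Case-1 membership, NO
non-anomalous binder (compare gz's end states `ClassX3Gord.bsdp[_three]_rankOne_of_facts_of_cycLineFact…`).
§3 the crux BY NAME reduced to the window: `gordTwoRankOne_of_facts_of_shaAnWindow` and the certified seam
`gordTwoRankOne_of_parts_shaAnWindow` (Λ-adic children asked AT THE PAIR only on off-Case-1 window rows).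

THE DATUM is not a theorem about any curve nor a class statement: `#Ш(E)_an ∈ ℚ` in rank one is Gross–Zagier
I.(7.3), its VALUE is table data (Cremona `allbsd` / LMFDB), as in F3BW. On the window `p ∣ #Ш_an` nothing here
applies (`p = 3`: the class-free `3`-descent road `missingLowerBoundAt_of_casselsTate_of_pow_succ_dvd_card_selmerGroup`;
`p ≥ 5`: the Λ-adic children only). References: [Miller2011LMS] §1, Def. 1.1; [Kato2004Asterisque] Thm. 17.4 (3);
[Wuthrich2014] Thm. 16, Lemma 20; [Delbourgo2002] Thm. (A), (B); [Disegni2017] Thm. A, B; [GrossZagier1986] I.(7.3);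
[Pal2012] Thm. 3.2; [LiLiuTian2024] Thm. 1.1 (i); cell TARGET.md §2, E39/E68/E74/E90, HOME/k1-c3/CERT-ROADS-19358-g4.md.
-/

set_option autoImplicit false
set_option linter.dupNamespace false
noncomputable section
open scoped Classical MatrixGroups ModularForm NumberField
open CongruenceSubgroup WeierstrassCurve NumberField IsDedekindDomain Field
  Literature.NumberTheory.EllipticCurves Literature.NumberTheory.EllipticCurves.ModularForms
  Literature.NumberTheory.EllipticCurves.GreenbergVatsal2000
  Literature.NumberTheory.EllipticCurves.Rank1Residual
  Literature.NumberTheory.EllipticCurves.Rank1Residual.Typed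
  Literature.NumberTheory.EllipticCurves.Delbourgo2002
  Literature.NumberTheory.EllipticCurves.Disegni2017
  Literature.NumberTheory.GaloisRepresentations
  Summit.BirchSwinnertonDyer.Rank1Residual.AdditivePotMult
  Summit.BirchSwinnertonDyer.Rank1Residual.Additive
  Summit.BirchSwinnertonDyer.BirchSwinnertonDyer.Theses.AdditiveBranchIMC

namespace Summit.BirchSwinnertonDyer.BirchSwinnertonDyer.Theorems.AdditiveBranchIMCGordTwoRankOne

variable {W : WeierstrassCurve ℚ} [W.IsElliptic] [W.IsGloballyMinimal] {p : ℕ} [hp : Fact p.Prime]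

/-! ### §0 The window: the lower half is FREE when `ord_p #Ш_an ≤ 0` (class-free, input-free)

The class-free core is ALREADY in the tree, stated for the rank-`0` class N10 by the b2b cell:
`N10.missingLowerBoundAt_of_padicValRat_le_zero` (`Additive/N10LowerHalfStatements.lean` §Content — "the content
rows of the conjecture are `p ∣ #Ш_an`"). It carries no rank hypothesis; this file READS it on the rank-ONE rows. -/

omit [W.IsElliptic] [W.IsGloballyMinimal] hp in
/-- The `ord_p s = 0` form of the window (the F3BW datum shape), via the tree's class-free
`N10.missingLowerBoundAt_of_padicValRat_le_zero`. [cite: Miller2011LMS, §1 and Def. 1.1] -/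
theorem missingLowerBoundAt_of_shaAn_padicValRat_eq_zero {s : ℚ} (hs : shaAn W = (s : ℂ))
    (hsv : padicValRat p s = 0) : MissingLowerBoundAt W p :=
  N10.missingLowerBoundAt_of_padicValRat_le_zero W p hs hsv.le

omit [W.IsElliptic] [W.IsGloballyMinimal] hp in
/-- **Dichotomy.** At every pair either the lower half holds for free (some rational value of `#Ш_an` with
`ord_p ≤ 0`) or the pair lies in the CONTENT WINDOW: every rational value `s` of `#Ш(E)_an` has `ord_p s > 0`
(in analytic rank `≤ 1` it is rational, Gross–Zagier I.(7.3)). Excluded middle only. [cite: Miller2011LMS, Def. 1.1] -/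
theorem missingLowerBoundAt_or_shaAnWindow (W : WeierstrassCurve ℚ) (p : ℕ) :
    MissingLowerBoundAt W p ∨ ∀ s : ℚ, shaAn W = (s : ℂ) → 0 < padicValRat p s := by
  by_cases h : ∃ s : ℚ, shaAn W = (s : ℂ) ∧ padicValRat p s ≤ 0
  · obtain ⟨s, hs, hsv⟩ := h
    exact Or.inl (N10.missingLowerBoundAt_of_padicValRat_le_zero W p hs hsv)
  · push Not at h
    exact Or.inr h

/-! ### §1 X4♯(G-ord) ∩ `I₀*` ∩ {`ρ̄` onto}, `r_an = 1`: `BSD(E,p)` from Kato's half + `A′ ≠ 0` + the datum -/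

/-- **X4♯(G-ord) ∩ `I₀*` ∩ {`ρ̄_{E,p}` onto}, `p ≡ 1 (mod 4)`, `r_an(E) = 1`, anomalous or not: `BSD(E,p)` from
Kato's half-eigenspace reading `hK`, the cite-only facts `hCyc hArt h73 hWald hmod hmodD hmodN hGZK`, the weak
certificate `A′ ≠ 0` (`BranchCoeffOneNeZeroAt W p`) and the datum `#Ш(E)_an = s`, `ord_p s ≤ 0`.** Chain: twist
model `C • V^{(p)} = W`, newform, `ϖ·Ω_V = Ω⁺_f`; datum `Dh` + kernel identity `ϖ·[T¹]L·log_p γ = u·q·Reg_p(E,Dh)`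
(`exists_datum_identity_of_facts`); Schneider(`Dh`) = the identity with `A′ ≠ 0`; UPPER =
`classX4Gord_missingUpperBoundAt_rankOne_of_katoHalf_of_identity`; LOWER = §0; `¬CM` from surjectivity.
Nothing booked. [cite: Kato2004Asterisque, Thm. 17.4 (3) (p. 273)]
[cite: Wuthrich2014, Lemma 20 (p. 399)] [cite: Delbourgo2002, Theorem (B) (p. 40)]
[cite: Disegni2017, Theorem A/B (arXiv v3 PDF 7–9)] [cite: Pal2012, Thm. 3.2] [cite: Miller2011LMS, Def. 1.1] -/
theorem classX4Gord_bsdp_rankOne_of_katoHalf_of_branchCoeffOneNeZero_of_shaAnUnit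
    (hK : Wuthrich2014.kato_halfEigenCharIdeal_dvd_cyclotomicPrime_of_surjective)
    (hCyc : delbourgoDatum_cycLineGrossZagier)
    (hArt : rankinSelbergEulerProductHecke_baseChangeDirichlet_eq) (h73 : GrossZagier1986_thm_I_7_3)
    (hWald : waldspurger_exists_heegnerField_twist_ne_zero)
    (hmod : hasEntireLFunction_rat) (hmodD : nonempty_modularParametrizationData)
    (hmodN : exists_isNewformOf) (hGZK : rank_eq_analyticRank_of_analyticRank_le_one)
    (hX : ClassX4Gord W p) (he : semistabilityIndex W p = 2) (hp4 : p % 4 = 1) (hsurj : Surj W p)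
    (hr : W.analyticRank = 1) (hne : BranchCoeffOneNeZeroAt W p)
    {s : ℚ} (hs : shaAn W = (s : ℂ)) (hsv : padicValRat p s ≤ 0) : BSDp W p := by
  have hp2 : p ≠ 2 := hX.addv.1
  have hcm : ¬ W.HasCM := not_hasCM_of_surj_of_ne_two hp2 hsurj
  obtain ⟨V, iV, iVm, C, hV, hC⟩ := hX.exists_goodOrd_pStar_twist_model W p he
  have hordin : IsOrdinaryAt V p := ⟨hV.1, hV.2⟩
  haveI : NeZero (V.conductorNorm ℤ) := ⟨(V.conductorNorm_pos_holds).ne'⟩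
  obtain ⟨Dm⟩ := hmodD V
  obtain ⟨ϖ, -, hϖ, -⟩ := Dm.exists_rat_mul_realPeriodRat_eq_plusPeriod
  obtain ⟨Dh, -, hB, u, q, hlead, hpgz⟩ := exists_datum_identity_of_facts hCyc hArt h73 hWald hmod hmodD hmodN
    hGZK hX.addv.2 hX.typeGOrd hp4 hcm hr V C hV hC Dm.isNewformOf ϖ hϖ
  have hSch : SchneiderConjecture Dh :=
    schneiderConjecture_of_identity_of_branchCoeffOneNeZero hp4 hne V C hC hordin Dm.f Dm.isNewformOf ϖ hϖ hpgz
  have hu : MissingUpperBoundAt W p :=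
    classX4Gord_missingUpperBoundAt_rankOne_of_katoHalf_of_identity hK hGZK hmod hX hp4 hsurj hr hB hSch V hV C hC
      Dm.isNewformOf ϖ hϖ hlead hpgz
  exact bsdp_of_missingPPartAt W p hGZK (by rw [hr])
    (missingPPartAt_of_lower_of_upper W p (N10.missingLowerBoundAt_of_padicValRat_le_zero W p hs hsv) hu)

/-- **X4♯(G-ord) ∩ `I₀*` ∩ {`ρ̄_{E,p}` onto}, `p ≡ 3 (mod 4)`, `p ≥ 7`, `r_an(E) = 1`, anomalous or not:
`BSD(E,p)` from Kato's half `hK`, the cite-only facts, `A′ ≠ 0` (minus modular symbols) and the datum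
`#Ш(E)_an = s`, `ord_p s ≤ 0`** — odd twin (`exists_datum_identity_odd_of_facts`, `ϖ·|Ω⁻_V| = Ω⁻_f`).
[cite: Kato2004Asterisque, Thm. 17.4 (3) (p. 273)] [cite: Wuthrich2014, Lemma 20 (p. 399)]
[cite: Delbourgo2002, Theorem (B) (p. 40)] [cite: Disegni2017, Theorem A/B (arXiv v3 PDF 7–9)] [cite: Miller2011LMS, Def. 1.1] -/
theorem classX4Gord_bsdp_rankOne_odd_of_katoHalf_of_branchCoeffOneNeZero_of_shaAnUnit
    (hK : Wuthrich2014.kato_halfEigenCharIdeal_dvd_cyclotomicPrime_of_surjective)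
    (hCyc : delbourgoDatum_cycLineGrossZagier)
    (hArt : rankinSelbergEulerProductHecke_baseChangeDirichlet_eq) (h73 : GrossZagier1986_thm_I_7_3)
    (hWald : waldspurger_exists_heegnerField_twist_ne_zero)
    (hmod : hasEntireLFunction_rat) (hmodD : nonempty_modularParametrizationData)
    (hmodN : exists_isNewformOf) (hGZK : rank_eq_analyticRank_of_analyticRank_le_one)
    (hX : ClassX4Gord W p) (he : semistabilityIndex W p = 2) (hp4 : p % 4 = 3) (hp5 : 5 ≤ p)
    (hsurj : Surj W p) (hr : W.analyticRank = 1) (hne : BranchCoeffOneNeZeroAt W p)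
    {s : ℚ} (hs : shaAn W = (s : ℂ)) (hsv : padicValRat p s ≤ 0) : BSDp W p := by
  have hp2 : p ≠ 2 := hX.addv.1
  have hcm : ¬ W.HasCM := not_hasCM_of_surj_of_ne_two hp2 hsurj
  obtain ⟨V, iV, iVm, C, hV, hC⟩ := hX.exists_goodOrd_pStar_twist_model W p he
  have hordin : IsOrdinaryAt V p := ⟨hV.1, hV.2⟩
  haveI : NeZero (V.conductorNorm ℤ) := ⟨(V.conductorNorm_pos_holds).ne'⟩
  obtain ⟨Dm⟩ := hmodD V
  obtain ⟨ϖ, -, hϖ⟩ := exists_rat_mul_imaginaryPeriodRat_eq_minusPeriod Dm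
  obtain ⟨Dh, -, hB, u, q, hlead, hpgz⟩ := exists_datum_identity_odd_of_facts hCyc hArt h73 hWald hmod hmodD
    hmodN hGZK hX.addv.2 hX.typeGOrd hp4 hp5 hcm hr V C hV hC Dm.isNewformOf ϖ hϖ
  have hSch : SchneiderConjecture Dh :=
    schneiderConjecture_of_identity_of_branchCoeffOneNeZero_odd hp4 hne V C hC hordin Dm.f Dm.isNewformOf ϖ
      hϖ hpgz
  have hu : MissingUpperBoundAt W p :=
    classX4Gord_missingUpperBoundAt_rankOne_of_katoHalf_of_identity_odd hK hGZK hmod hX hp4 hsurj hr hB hSch V hV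
      C hC Dm.isNewformOf ϖ hϖ hlead hpgz
  exact bsdp_of_missingPPartAt W p hGZK (by rw [hr])
    (missingPPartAt_of_lower_of_upper W p (N10.missingLowerBoundAt_of_padicValRat_le_zero W p hs hsv) hu)

/-- **X4♯(G-ord) at `p = 3` (`e = 2` automatic) ∩ {`ρ̄_{E,3}` onto}, `r_an(E) = 1`, ANOMALOUS OR NOT: `BSD(E,3)`
from Kato's half `hK`, the cite-only facts (`hCyc`: fact (B)'s evaluated clauses feed the upper half — no
`hCyc3`, no `hDel3`), `A′(E,3) ≠ 0` and the datum `#Ш(E)_an = s`, `ord_3 s ≤ 0`** (`exists_datum_identity_three_of_facts`).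
[cite: Kato2004Asterisque, Thm. 17.4 (3) (p. 273)] [cite: Delbourgo2002, Theorem (B), Example (p. 40)]
[cite: Disegni2017, Theorem A/B (arXiv v3 PDF 7–9)] [cite: Miller2011LMS, Def. 1.1] -/
theorem classX4Gord_bsdp_rankOne_three_of_katoHalf_of_branchCoeffOneNeZero_of_shaAnUnit
    [Fact (Nat.Prime 3)] {W : WeierstrassCurve ℚ} [W.IsElliptic] [W.IsGloballyMinimal]
    (hK : Wuthrich2014.kato_halfEigenCharIdeal_dvd_cyclotomicPrime_of_surjective)
    (hCyc : delbourgoDatum_cycLineGrossZagier)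
    (hArt : rankinSelbergEulerProductHecke_baseChangeDirichlet_eq) (h73 : GrossZagier1986_thm_I_7_3)
    (hWald : waldspurger_exists_heegnerField_twist_ne_zero)
    (hmod : hasEntireLFunction_rat) (hmodD : nonempty_modularParametrizationData)
    (hmodN : exists_isNewformOf) (hGZK : rank_eq_analyticRank_of_analyticRank_le_one)
    (hX : ClassX4Gord W 3) (hsurj : Surj W 3) (hr : W.analyticRank = 1) (hne : BranchCoeffOneNeZeroAt W 3)
    {s : ℚ} (hs : shaAn W = (s : ℂ)) (hsv : padicValRat 3 s ≤ 0) : BSDp W 3 := by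
  have hp4 : (3 : ℕ) % 4 = 3 := by norm_num
  have hp2 : (3 : ℕ) ≠ 2 := by norm_num
  have hcm : ¬ W.HasCM := not_hasCM_of_surj_of_ne_two hp2 hsurj
  have he : semistabilityIndex W 3 = 2 :=
    semistabilityIndex_eq_two_of_typeG_three W hX.typeGOrd.typeG hX.addv.2
  obtain ⟨V, iV, iVm, C, hV, hC⟩ := hX.exists_goodOrd_pStar_twist_model W 3 he
  have hordin : IsOrdinaryAt V 3 := ⟨hV.1, hV.2⟩
  haveI : NeZero (V.conductorNorm ℤ) := ⟨(V.conductorNorm_pos_holds).ne'⟩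
  obtain ⟨Dm⟩ := hmodD V
  obtain ⟨ϖ, -, hϖ⟩ := exists_rat_mul_imaginaryPeriodRat_eq_minusPeriod Dm
  obtain ⟨Dh, hB, u, q, hlead, hpgz⟩ := exists_datum_identity_three_of_facts hCyc hArt h73 hWald hmod hmodD
    hmodN hGZK hX.addv.2 hX.typeGOrd hcm hr V C hV hC Dm.isNewformOf ϖ hϖ
  have hSch : SchneiderConjecture Dh :=
    schneiderConjecture_of_identity_of_branchCoeffOneNeZero_odd hp4 hne V C hC hordin Dm.f Dm.isNewformOf ϖ
      hϖ hpgz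
  have hu : MissingUpperBoundAt W 3 :=
    classX4Gord_missingUpperBoundAt_rankOne_of_katoHalf_of_identity_odd hK hGZK hmod hX hp4 hsurj hr hB hSch V hV
      C hC Dm.isNewformOf ϖ hϖ hlead hpgz
  exact bsdp_of_missingPPartAt W 3 hGZK (by rw [hr])
    (missingPPartAt_of_lower_of_upper W 3 (N10.missingLowerBoundAt_of_padicValRat_le_zero W 3 hs hsv) hu)

/-! ### §2 X3♯(G-ord) ∩ `I₀*` (`E[p]` reducible), `r_an = 1`: `BSD(E,p)` from Wuthrich's half + `A′ ≠ 0` + the datum -/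

/-- **X3♯(G-ord) ∩ `I₀*` (`E[p]` reducible, `e = 2`), `p ≡ 1 (mod 4)`, `r_an(E) = 1`, anomalous or not, Case-1
member OR NOT, line datum OR NOT: `BSD(E,p)` from Wuthrich's half-eigenspace reading `hW16`, the cite-only facts
`hCyc hArt h73 hWald hmod hmodD hmodN hGZK`, `A′ ≠ 0` and the datum `#Ш(E)_an = s`, `ord_p s ≤ 0`.** As §1 with
UPPER = `ClassX3Gord.missingUpperBoundAt_rankOne_of_wuthrichHalf_of_identity`, `¬CM` by `not_hasCM_of_classX3Gord`.
Versus the booked end state `ClassX3Gord.bsdp_rankOne_of_facts_of_cycLineFact_of_branchCoeffOneNeZero`: no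
`hGV h23 h414 hGrK hLiftF`, no `hMaz hDel`, no `hna`, no `Φ₀ / IsRationalLine / LineEven / inertia clause`.
[cite: Wuthrich2014, Thm. 16 (p. 397)] [cite: Delbourgo2002, Theorem (B) (p. 40)]
[cite: Disegni2017, Theorem A/B (arXiv v3 PDF 7–9)] [cite: Pal2012, Thm. 3.2] [cite: Miller2011LMS, Def. 1.1] -/
theorem classX3Gord_bsdp_rankOne_of_wuthrichHalf_of_branchCoeffOneNeZero_of_shaAnUnit
    (hW16 : Wuthrich2014.thm16_halfEigenCharIdeal_dvd_cyclotomicPrime)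
    (hCyc : delbourgoDatum_cycLineGrossZagier)
    (hArt : rankinSelbergEulerProductHecke_baseChangeDirichlet_eq) (h73 : GrossZagier1986_thm_I_7_3)
    (hWald : waldspurger_exists_heegnerField_twist_ne_zero)
    (hmod : hasEntireLFunction_rat) (hmodD : nonempty_modularParametrizationData)
    (hmodN : exists_isNewformOf) (hGZK : rank_eq_analyticRank_of_analyticRank_le_one)
    (hX : ClassX3Gord W p) (he : semistabilityIndex W p = 2) (hp4 : p % 4 = 1) (hr : W.analyticRank = 1)
    (hne : BranchCoeffOneNeZeroAt W p) {s : ℚ} (hs : shaAn W = (s : ℂ)) (hsv : padicValRat p s ≤ 0) :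
    BSDp W p := by
  have hp2 : p ≠ 2 := by omega
  have hcm : ¬ W.HasCM := not_hasCM_of_classX3Gord hX hp2
  obtain ⟨V, iV, iVm, C, hV, hC⟩ := hX.exists_goodOrd_pStar_twist_model W p hp2 he
  have hordin : IsOrdinaryAt V p := ⟨hV.1, hV.2⟩
  haveI : NeZero (V.conductorNorm ℤ) := ⟨(V.conductorNorm_pos_holds).ne'⟩
  obtain ⟨Dm⟩ := hmodD V
  obtain ⟨ϖ, -, hϖ, -⟩ := Dm.exists_rat_mul_realPeriodRat_eq_plusPeriod
  obtain ⟨Dh, -, hB, u, q, hlead, hpgz⟩ := exists_datum_identity_of_facts hCyc hArt h73 hWald hmod hmodD hmodN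
    hGZK hX.addv hX.typeGOrd hp4 hcm hr V C hV hC Dm.isNewformOf ϖ hϖ
  have hSch : SchneiderConjecture Dh :=
    schneiderConjecture_of_identity_of_branchCoeffOneNeZero hp4 hne V C hC hordin Dm.f Dm.isNewformOf ϖ hϖ hpgz
  have hu : MissingUpperBoundAt W p :=
    ClassX3Gord.missingUpperBoundAt_rankOne_of_wuthrichHalf_of_identity hW16 hGZK hmod hX hp4 hr hB hSch V hV C hC
      Dm.isNewformOf ϖ hϖ hlead hpgz
  exact bsdp_of_missingPPartAt W p hGZK (by rw [hr])
    (missingPPartAt_of_lower_of_upper W p (N10.missingLowerBoundAt_of_padicValRat_le_zero W p hs hsv) hu)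

/-- **X3♯(G-ord) ∩ `I₀*`, `p ≡ 3 (mod 4)`, `p ≥ 7`, `r_an(E) = 1`, anomalous or not, Case-1 member or not, line
datum or not: `BSD(E,p)` from Wuthrich's half `hW16`, the cite-only facts, `A′ ≠ 0` (minus symbols) and the
datum `#Ш(E)_an = s`, `ord_p s ≤ 0`** — odd twin. [cite: Wuthrich2014, Thm. 16 (p. 397)] [cite: Delbourgo2002, Theorem (B) (p. 40)]
[cite: Disegni2017, Theorem A/B (arXiv v3 PDF 7–9)] [cite: MazurTateTeitelbaum1986Invent, §I.13–I.14]
[cite: Miller2011LMS, Def. 1.1] -/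
theorem classX3Gord_bsdp_rankOne_odd_of_wuthrichHalf_of_branchCoeffOneNeZero_of_shaAnUnit
    (hW16 : Wuthrich2014.thm16_halfEigenCharIdeal_dvd_cyclotomicPrime)
    (hCyc : delbourgoDatum_cycLineGrossZagier)
    (hArt : rankinSelbergEulerProductHecke_baseChangeDirichlet_eq) (h73 : GrossZagier1986_thm_I_7_3)
    (hWald : waldspurger_exists_heegnerField_twist_ne_zero)
    (hmod : hasEntireLFunction_rat) (hmodD : nonempty_modularParametrizationData)
    (hmodN : exists_isNewformOf) (hGZK : rank_eq_analyticRank_of_analyticRank_le_one)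
    (hX : ClassX3Gord W p) (he : semistabilityIndex W p = 2) (hp4 : p % 4 = 3) (hp5 : 5 ≤ p)
    (hr : W.analyticRank = 1) (hne : BranchCoeffOneNeZeroAt W p)
    {s : ℚ} (hs : shaAn W = (s : ℂ)) (hsv : padicValRat p s ≤ 0) : BSDp W p := by
  have hp2 : p ≠ 2 := by omega
  have hcm : ¬ W.HasCM := not_hasCM_of_classX3Gord hX hp2
  obtain ⟨V, iV, iVm, C, hV, hC⟩ := hX.exists_goodOrd_pStar_twist_model W p hp2 he
  have hordin : IsOrdinaryAt V p := ⟨hV.1, hV.2⟩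
  haveI : NeZero (V.conductorNorm ℤ) := ⟨(V.conductorNorm_pos_holds).ne'⟩
  obtain ⟨Dm⟩ := hmodD V
  obtain ⟨ϖ, -, hϖ⟩ := exists_rat_mul_imaginaryPeriodRat_eq_minusPeriod Dm
  obtain ⟨Dh, -, hB, u, q, hlead, hpgz⟩ := exists_datum_identity_odd_of_facts hCyc hArt h73 hWald hmod hmodD
    hmodN hGZK hX.addv hX.typeGOrd hp4 hp5 hcm hr V C hV hC Dm.isNewformOf ϖ hϖ
  have hSch : SchneiderConjecture Dh :=
    schneiderConjecture_of_identity_of_branchCoeffOneNeZero_odd hp4 hne V C hC hordin Dm.f Dm.isNewformOf ϖ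
      hϖ hpgz
  have hu : MissingUpperBoundAt W p :=
    ClassX3Gord.missingUpperBoundAt_rankOne_of_wuthrichHalf_of_identity_odd hW16 hGZK hmod hX hp4 hr hB hSch V hV C
      hC Dm.isNewformOf ϖ hϖ hlead hpgz
  exact bsdp_of_missingPPartAt W p hGZK (by rw [hr])
    (missingPPartAt_of_lower_of_upper W p (N10.missingLowerBoundAt_of_padicValRat_le_zero W p hs hsv) hu)

/-- **X3♯(G-ord) at `p = 3` (`e = 2` automatic), `r_an(E) = 1`, ANOMALOUS OR NOT, Case-1 line datum OR NOT:
`BSD(E,3)` from Wuthrich's half `hW16`, the cite-only facts (`hCyc`, no `hCyc3`/`hDel3`), `A′(E,3) ≠ 0` and the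
datum `#Ш(E)_an = s`, `ord_3 s ≤ 0`.** The cell's `p = 3` X3♯ r1 universe (book230: 799 keys, 394 gated on the
`A′@3` campaign after R284) read WITHOUT line datum / anomalous split: per key Wuthrich's reading, `A′(E,3) ≠ 0`,
`3 ∤ #Ш(E)_an`. Nothing booked. [cite: Wuthrich2014, Thm. 16 (p. 397)] [cite: Delbourgo2002, Theorem (B), Example (p. 40)]
[cite: Disegni2017, Theorem A/B (arXiv v3 PDF 7–9)] [cite: Miller2011LMS, Def. 1.1] -/
theorem classX3Gord_bsdp_rankOne_three_of_wuthrichHalf_of_branchCoeffOneNeZero_of_shaAnUnit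
    [Fact (Nat.Prime 3)] {W : WeierstrassCurve ℚ} [W.IsElliptic] [W.IsGloballyMinimal]
    (hW16 : Wuthrich2014.thm16_halfEigenCharIdeal_dvd_cyclotomicPrime)
    (hCyc : delbourgoDatum_cycLineGrossZagier)
    (hArt : rankinSelbergEulerProductHecke_baseChangeDirichlet_eq) (h73 : GrossZagier1986_thm_I_7_3)
    (hWald : waldspurger_exists_heegnerField_twist_ne_zero)
    (hmod : hasEntireLFunction_rat) (hmodD : nonempty_modularParametrizationData)
    (hmodN : exists_isNewformOf) (hGZK : rank_eq_analyticRank_of_analyticRank_le_one)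
    (hX : ClassX3Gord W 3) (hr : W.analyticRank = 1) (hne : BranchCoeffOneNeZeroAt W 3)
    {s : ℚ} (hs : shaAn W = (s : ℂ)) (hsv : padicValRat 3 s ≤ 0) : BSDp W 3 := by
  have hp4 : (3 : ℕ) % 4 = 3 := by norm_num
  have hp2 : (3 : ℕ) ≠ 2 := by norm_num
  have hcm : ¬ W.HasCM := not_hasCM_of_classX3Gord hX hp2
  have he : semistabilityIndex W 3 = 2 :=
    semistabilityIndex_eq_two_of_typeG_three W hX.typeGOrd.typeG hX.addv
  obtain ⟨V, iV, iVm, C, hV, hC⟩ := hX.exists_goodOrd_pStar_twist_model W 3 hp2 he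
  have hordin : IsOrdinaryAt V 3 := ⟨hV.1, hV.2⟩
  haveI : NeZero (V.conductorNorm ℤ) := ⟨(V.conductorNorm_pos_holds).ne'⟩
  obtain ⟨Dm⟩ := hmodD V
  obtain ⟨ϖ, -, hϖ⟩ := exists_rat_mul_imaginaryPeriodRat_eq_minusPeriod Dm
  obtain ⟨Dh, hB, u, q, hlead, hpgz⟩ := exists_datum_identity_three_of_facts hCyc hArt h73 hWald hmod hmodD
    hmodN hGZK hX.addv hX.typeGOrd hcm hr V C hV hC Dm.isNewformOf ϖ hϖ
  have hSch : SchneiderConjecture Dh :=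
    schneiderConjecture_of_identity_of_branchCoeffOneNeZero_odd hp4 hne V C hC hordin Dm.f Dm.isNewformOf ϖ
      hϖ hpgz
  have hu : MissingUpperBoundAt W 3 :=
    ClassX3Gord.missingUpperBoundAt_rankOne_of_wuthrichHalf_of_identity_odd hW16 hGZK hmod hX hp4 hr hB hSch V hV C
      hC Dm.isNewformOf ϖ hϖ hlead hpgz
  exact bsdp_of_missingPPartAt W 3 hGZK (by rw [hr])
    (missingPPartAt_of_lower_of_upper W 3 (N10.missingLowerBoundAt_of_padicValRat_le_zero W 3 hs hsv) hu)

/-! ### §3 Crux `GordTwoRankOne` (item 19358) BY NAME, reduced to its CONTENT WINDOW `p ∣ #Ш_an` -/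

/-- **CRUX `GordTwoRankOne` BY NAME, REDUCED TO THE CONTENT WINDOW.** GRANTED the crux's own statement on the
non-CM cell pairs of analytic rank `1` which are BOTH off the unit slice (`¬ BranchUnitCoeffAt W p 1`: `v_p(A′) ≥ 1`
or `A′ = 0`) AND in the content window (`p ∣ #Ш(E)_an`: every rational value `s` of `#Ш(E)_an` has `ord_p s > 0`)
— `hWindow`, DISPLAYED, not asserted: the open part of item 19358 after gen 5 — the route decl `GordTwoRankOne`
follows from the twelve published binders and Li–Liu–Tian (`hLLT`, CM rows): gen 4's
`gordTwoRankOne_of_facts_of_contentRows` ∘ `missingLowerBoundAt_or_shaAnWindow`. [cite: LiLiuTian2024, Thm. 1.1 (i)] [cite: Delbourgo2002, Theorem (A), (B) (p. 40)] [cite: Disegni2017, Theorem A/B]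
[cite: Mazur1972Towers, Cor. 5.15] [cite: Miller2011LMS, Def. 1.1] -/
theorem gordTwoRankOne_of_facts_of_shaAnWindow
    (hMaz : Mazur1972.cor515_universalNormIndex) (hCyc : delbourgoDatum_cycLineGrossZagier)
    (hCyc3 : delbourgoDatum_cycLineGrossZagier_intrinsicThree)
    (hArt : rankinSelbergEulerProductHecke_baseChangeDirichlet_eq) (h73 : GrossZagier1986_thm_I_7_3)
    (hWald : waldspurger_exists_heegnerField_twist_ne_zero) (hDel : Delbourgo2002.mainTheorem)
    (hDel3 : Delbourgo2002.mainTheorem_three)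
    (hmod : hasEntireLFunction_rat) (hmodD : nonempty_modularParametrizationData)
    (hmodN : exists_isNewformOf) (hGZK : rank_eq_analyticRank_of_analyticRank_le_one)
    (hLLT : LiLiuTian2024.thm11_bsdp_of_cm_rank_one)
    (hWindow : ∀ (W : WeierstrassCurve ℚ) [W.IsElliptic] [W.IsGloballyMinimal] (p : ℕ) [Fact p.Prime],
      W.analyticRank = 1 → N10.CellGordTwo W p → ¬ W.HasCM → ¬ BranchUnitCoeffAt W p 1 →
      (∀ s : ℚ, shaAn W = (s : ℂ) → 0 < padicValRat p s) → MissingLowerBoundAt W p) :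
    GordTwoRankOne :=
  gordTwoRankOne_of_facts_of_contentRows hMaz hCyc hCyc3 hArt h73 hWald hDel hDel3 hmod hmodD hmodN hGZK hLLT
    fun W _ _ p _ hr hc hcm hunit ↦
      (missingLowerBoundAt_or_shaAnWindow W p).elim id (hWindow W p hr hc hcm hunit)

/-- **The CERTIFIED SEAM of the split with the Λ-adic children ASKED ONLY ON THE CONTENT WINDOW.** From
`PrintedFacts`, `ReadingFacts`, the ten by-name leaves and `hLLT` as in gen 2's `gordTwoRankOne_of_parts`, the
certificate child `hCert` as there (`A′ ≠ 0` on every non-CM cell pair of analytic rank `1`), and the branch lower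
containments `hΛc` (plus, `p ≡ 1 (mod 4)`) / `hΛc'` (minus, `p ≡ 3 (mod 4)`, `p = 3` included) asked AT THE PAIR
and ONLY on off-Case-1, non-CM, analytic-rank-`1` rows with `¬ BranchUnitCoeffAt W p 1` AND `p ∣ #Ш(E)_an`
(`∀ s, shaAn W = s → 0 < ord_p s`) — the route decl `GordTwoRankOne` follows BY NAME: in rank one the crux
consumes items 19497/19498 only through the cell's CONTENT WINDOW (TARGET §2: `p ∣ #Ш_an`). Dispatch: CM → LLT;
unit slice → gen 4 §5; unit window → §0; Case-1 member → gz ∘ Cassels; off-Case-1 window → gen 0's cores.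
[cite: LiLiuTian2024, Thm. 1.1 (i)] [cite: Delbourgo2002, Theorem (A), (B) (p. 40)] [cite: Disegni2017, Theorem A/B]
[cite: GreenbergVatsal2000, §3 Thm. (3.12) p. 45] [cite: Wuthrich2014, Thm. 16 (p. 397)] [cite: Mazur1972Towers, Cor. 5.15]
[cite: MilneADT2006, Thm. I.7.3] [cite: Miller2011LMS, Def. 1.1] -/
theorem gordTwoRankOne_of_parts_shaAnWindow (hP : PrintedFacts) (hR : ReadingFacts)
    (hMaz : Mazur1972.cor515_universalNormIndex) (hCyc : delbourgoDatum_cycLineGrossZagier)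
    (hCyc3 : delbourgoDatum_cycLineGrossZagier_intrinsicThree)
    (hArt : rankinSelbergEulerProductHecke_baseChangeDirichlet_eq) (h73 : GrossZagier1986_thm_I_7_3)
    (hWald : waldspurger_exists_heegnerField_twist_ne_zero) (hDel : Delbourgo2002.mainTheorem)
    (hDel3 : Delbourgo2002.mainTheorem_three) (hmodN : exists_isNewformOf)
    (hLLT : LiLiuTian2024.thm11_bsdp_of_cm_rank_one)
    (hΛc : ∀ (W : WeierstrassCurve ℚ) [W.IsElliptic] [W.IsGloballyMinimal] (p : ℕ) [Fact p.Prime],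
      W.analyticRank = 1 → N10.CellGordTwo W p → ¬ HasCaseOneMember W p → ¬ W.HasCM →
      ¬ BranchUnitCoeffAt W p 1 → (∀ s : ℚ, shaAn W = (s : ℂ) → 0 < padicValRat p s) → p % 4 = 1 →
      ChiBranchLowerDivisibilityAt W p)
    (hΛc' : ∀ (W : WeierstrassCurve ℚ) [W.IsElliptic] [W.IsGloballyMinimal] (p : ℕ) [Fact p.Prime],
      W.analyticRank = 1 → N10.CellGordTwo W p → ¬ HasCaseOneMember W p → ¬ W.HasCM →
      ¬ BranchUnitCoeffAt W p 1 → (∀ s : ℚ, shaAn W = (s : ℂ) → 0 < padicValRat p s) → p % 4 = 3 →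
      ChiBranchLowerDivisibilityOddAt W p)
    (hCert : ∀ (W : WeierstrassCurve ℚ) [W.IsElliptic] [W.IsGloballyMinimal] (p : ℕ) [Fact p.Prime],
      W.analyticRank = 1 → N10.CellGordTwo W p → ¬ W.HasCM → BranchCoeffOneNeZeroAt W p) :
    GordTwoRankOne := by
  -- adapted from gen 4's `gordTwoRankOne_of_parts_contentRows` (file `…UnitSliceCrux`), one case added
  obtain ⟨h23, h414, hGrK, -, hGZK, hmod, hmodD, hCassels⟩ := hP
  obtain ⟨hW16, hGV, hLiftF, hLiftE, -⟩ := hR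
  intro W _ _ p _ hr hc
  by_cases hcm : W.HasCM
  · exact gordTwoRankOne_cm_of_liLiuTian hLLT W p hr hc hcm
  by_cases hunit : BranchUnitCoeffAt W p 1
  · exact gordTwoRankOne_unitSlice_of_facts_cmFree hMaz hCyc hCyc3 hArt h73 hWald hDel hDel3 hmod hmodD hmodN
      hGZK W p hr hc hcm hunit
  rcases missingLowerBoundAt_or_shaAnWindow W p with hfree | hwin
  · exact hfree
  by_cases hm : HasCaseOneMember W p
  · exact gordTwoRankOne_caseOne_of_facts_of_classCert hW16 hGV h23 h414 hGrK hLiftF hLiftE hMaz hCyc hCyc3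
      hArt h73 hWald hDel hDel3 hmod hmodD hmodN hGZK hCassels W p hr hc hcm
      (classCert_of_forall_branchCoeffOneNeZeroAt hCert hr hc hcm) hm
  · have hne : BranchCoeffOneNeZeroAt W p := hCert W p hr hc hcm
    by_cases hp3 : p = 3
    · subst hp3
      exact cellGordTwo_missingLowerBoundAt_rankOne_three_intrinsic_of_facts_of_chiBranchLowerOdd_of_branchCoeffOneNeZero
        hMaz hCyc3 hArt h73 hWald hDel3 hmod hmodD hmodN hGZK hc hcm hr (hΛc' W 3 hr hc hm hcm hunit hwin rfl) hne
    · have hp5 : 5 ≤ p := (Fact.out : p.Prime).five_le_of_ne_two_of_ne_three hc.1 hp3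
      have hodd : p % 4 = 1 ∨ p % 4 = 3 := by
        obtain ⟨k, hk⟩ := (Fact.out : p.Prime).odd_of_ne_two hc.1
        omega
      rcases hodd with h1 | h3
      · exact cellGordTwo_missingLowerBoundAt_rankOne_of_facts_of_chiBranchLower_of_branchCoeffOneNeZero hMaz hCyc
          hArt h73 hWald hDel hmod hmodD hmodN hGZK hc h1 hcm hr (hΛc W p hr hc hm hcm hunit hwin h1) hne
      · exact cellGordTwo_missingLowerBoundAt_rankOne_odd_of_facts_of_chiBranchLowerOdd_of_branchCoeffOneNeZero
          hMaz hCyc hArt h73 hWald hDel hmod hmodD hmodN hGZK hc h3 hp5 hcm hr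
          (hΛc' W p hr hc hm hcm hunit hwin h3) hne

end Summit.BirchSwinnertonDyer.BirchSwinnertonDyer.Theorems.AdditiveBranchIMCGordTwoRankOne

end
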